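import Summits.ResolutionOfSingularities.ResolutionOfSingularities.Theorems.PurelyInseparableDim4JointTreeRoot
import Summits.ResolutionOfSingularities.ResolutionOfSingularities.Theorems.PurelyInseparableDim4JointInstance
import HarnessLib

/-!
# Purely inseparable four-folds: a TWO-MEMBER instance of the joint tree — `z^p + (x₁^{2p} − x₁^p)·x₃` is
# order-reduced by blowing up the two disjoint 3-folds `V(z, x₁)` and `V(z, x₁ − 1)`, for every prime `p`
# (brick S3 (c) «joint point∘coordinate chains», part 9, cell `res-dim4-pi`)

[OURS · counted 0] (D-0157 DOOR 2; desk WORD #66 (4)(c), #74 (g); frame `PIDim4.TerminationImpliesOrderReduction`,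
S3 (c); host item stmt-ResolutionOfSingularities-16155, helper). Nothing here proves resolution of singularities in
dimension ≥ 4 / characteristic `p` — NOT here, not anywhere in this programme.

`F = x₁^{2p} x₃ − x₁^p x₃ = (x₁^p)(x₁^p − 1)·x₃` (`K = K̄` of characteristic `p`, any prime `p`). The `x₃`-coefficient of
`F(x + b)` is `b₁^p (b₁^p − 1)` (`coeff_single_two_translate_inst₂`), so the closed order-`p` points of `z^p + F` are
exactly those with `b₁ ∈ {0, 1}`: the two DISJOINT 3-folds `{x₁ = 0}` and `{x₁ = 1}` of the hypersurface. Both are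
initial coordinate members in the sense of part 8 (`S = {x₁}`; re-centred cleaned equations `F` itself and
`x₁^{2p} x₃ + x₁^p x₃`, both in `(x₁)^p`), SEPARATED at the coordinate `x₁`; in the single chart of either blow-up the
transform reads `(x₁^p ∓ 1)·x₃`, whose linear monomial `x₃` survives every translation (no equimultiple pair); no root
parameter lies off the two members. Hence, by `exists_isMarkedResolution_joint_root`:

* **`exists_isMarkedResolution_inst₂`** — `(𝔸⁵_K, (z^p + x₁^{2p} x₃ − x₁^p x₃)·𝒪, [], p)` admits a marked resolution
  (BGMW Def. 3.1.3), obtained by blowing up the two members in turn: the first kernel instance of the joint tree with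
  MORE THAN ONE positive-dimensional centre. UNCONDITIONAL.

§1 computations (`coeff_single_mul_X_add_C`: the `x_i`-coefficient of `P·(x_i + v)` for `P` free of `x_i`; translates,
chart transforms, cleanliness, permissibility); §2 the certificate. AI-produced formalisation, weaker than expert review.
bears_on: LADDER-RESOLUTION:D157-DOOR2 (res-dim4-pi · S3 (c) joint · instance).
-/

set_option linter.dupNamespace false -- D-0017: single-problem summit path `Summit.<S>.<S>.…` by design

noncomputable section

open MvPolynomial Finset CategoryTheory AlgebraicGeometry Opposite TopologicalSpace

namespace Summit.ResolutionOfSingularities.ResolutionOfSingularities.Theorems.PIDim4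

open Literature.AlgebraicGeometry.Resolution
open Literature.AlgebraicGeometry.Resolution.Hauser2010
open Literature.AlgebraicGeometry.Resolution.AffinePointBlowup (P A γ coord Wtop ξ)

namespace Equimultiple

section Instance₂

variable {K : Type} [Field K] {p : ℕ} [hp : Fact p.Prime] [CharP K p]

/-! ## §1 Computations for `F = x₁^{2p} x₃ − x₁^p x₃` and the members `(0, {x₁})`, `((1,0,0,0), {x₁})` -/

omit hp [CharP K p] in
/-- The `x₃`-coefficient of `P·(x₃ + v)` is the constant term of `P` when `P` has no `x₃`-coefficient. [folklore] -/
theorem coeff_single_two_mul_X_add_C (P : MvPolynomial (Fin 4) K) (v : K) (hP : coeff (Finsupp.single 2 1) P = 0) :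
    coeff (Finsupp.single 2 1) (P * (X 2 + C v)) = coeff 0 P := by
  rw [mul_add, coeff_add, coeff_mul_X', if_pos (by simp), mul_comm P (C v), coeff_C_mul, hP, mul_zero, add_zero]
  simp

omit hp [CharP K p] in
/-- The polynomial `x₁^m + u·x₁^n + w` in `x₁` (`m, n ≠ 0`) has no `x₃`-coefficient and constant term `w`. [folklore] -/
theorem coeff_X_zero_poly {m n : ℕ} (hm : m ≠ 0) (hn : n ≠ 0) (u w : K) :
    coeff (Finsupp.single 2 1) (X 0 ^ m + C u * X 0 ^ n + C w : MvPolynomial (Fin 4) K) = 0 ∧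
      coeff 0 (X 0 ^ m + C u * X 0 ^ n + C w : MvPolynomial (Fin 4) K) = w := by
  have h1 : ∀ k : ℕ, coeff (Finsupp.single (2 : Fin 4) 1) (X 0 ^ k : MvPolynomial (Fin 4) K) = 0 := by
    intro k
    rw [X_pow_eq_monomial, coeff_monomial, if_neg]
    intro h
    have := DFunLike.congr_fun h 2
    rw [Finsupp.single_eq_same, Finsupp.single_eq_of_ne (by decide : (2 : Fin 4) ≠ 0)] at this
    exact one_ne_zero this.symm
  have h2 : ∀ k : ℕ, k ≠ 0 → coeff (0 : Fin 4 →₀ ℕ) (X 0 ^ k : MvPolynomial (Fin 4) K) = 0 := by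
    intro k hk
    rw [X_pow_eq_monomial, coeff_monomial, if_neg]
    intro h
    have := DFunLike.congr_fun h 0
    rw [Finsupp.single_eq_same, Finsupp.zero_apply] at this
    exact hk this
  constructor
  · rw [coeff_add, coeff_add, coeff_C_mul, h1, h1, mul_zero, add_zero, zero_add, coeff_C, if_neg]
    exact Ne.symm (Finsupp.single_ne_zero.mpr one_ne_zero)
  · rw [coeff_add, coeff_add, coeff_C_mul, h2 _ hm, h2 _ hn, mul_zero, add_zero, zero_add, coeff_C, if_pos rfl]

/-- **The `x₃`-coefficient of `F(x + b)` is `b₁^p (b₁^p − 1)`**: `F(x + b) = ((x₁ + b₁)^{2p} − (x₁ + b₁)^p)(x₃ + b₃)` and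
`(x₁ + b₁)^p = x₁^p + b₁^p`. [folklore] -/
theorem coeff_single_two_translate_inst₂ (b : Fin 4 → K) :
    coeff (Finsupp.single 2 1) (PointBlowup.translate b (X 0 ^ (2 * p) * X 2 - X 0 ^ p * X 2 : MvPolynomial (Fin 4) K)) =
      (b 0 ^ p) ^ 2 - b 0 ^ p := by
  unfold PointBlowup.translate
  simp only [map_sub, map_mul, map_pow, aeval_X]
  have hexp : ((X 0 + C (b 0)) ^ (2 * p) * (X 2 + C (b 2)) - (X 0 + C (b 0)) ^ p * (X 2 + C (b 2)) :
      MvPolynomial (Fin 4) K) =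
      (X 0 ^ (2 * p) + C (2 * b 0 ^ p - 1) * X 0 ^ p + C ((b 0 ^ p) ^ 2 - b 0 ^ p)) * (X 2 + C (b 2)) := by
    rw [pow_mul', add_pow_char, ← map_pow, pow_mul']
    simp only [map_sub, map_mul, map_pow, map_ofNat, map_one]
    ring
  have hp0 : p ≠ 0 := hp.out.ne_zero
  rw [hexp, coeff_single_two_mul_X_add_C _ _ (coeff_X_zero_poly (by omega) hp0 _ _).1,
    (coeff_X_zero_poly (by omega) hp0 _ _).2]

/-- **`F` translated to `(1, 0, 0, 0)` is `x₁^{2p} x₃ + x₁^p x₃`** (`(x₁ + 1)^p = x₁^p + 1` in characteristic `p`). [folklore] -/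
theorem translate_update_inst₂ :
    PointBlowup.translate (Function.update (0 : Fin 4 → K) 0 1)
        (X 0 ^ (2 * p) * X 2 - X 0 ^ p * X 2 : MvPolynomial (Fin 4) K) =
      X 0 ^ (2 * p) * X 2 + X 0 ^ p * X 2 := by
  unfold PointBlowup.translate
  simp only [map_sub, map_mul, map_pow, aeval_X, Function.update_self,
    Function.update_of_ne (show (2 : Fin 4) ≠ 0 by decide), Pi.zero_apply, map_zero, add_zero, map_one]
  rw [pow_mul', add_pow_char, one_pow, pow_mul']
  ring

omit hp [CharP K p] in
/-- The support of `x₁^m x₃ + c·x₁^n x₃` lies in its two exponents. [folklore] -/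
theorem mem_support_inst₂ {m n : ℕ} {c : K} {d : Fin 4 →₀ ℕ}
    (hd : d ∈ (X 0 ^ m * X 2 + C c * (X 0 ^ n * X 2) : MvPolynomial (Fin 4) K).support) :
    d = Finsupp.single 0 m + Finsupp.single 2 1 ∨ d = Finsupp.single 0 n + Finsupp.single 2 1 := by
  rw [X_pow_mul_X_eq_monomial, X_pow_mul_X_eq_monomial, C_mul_monomial] at hd
  rcases Finset.mem_union.mp (Finset.mem_of_subset MvPolynomial.support_add hd) with hd' | hd'
  · exact Or.inl (Finset.mem_singleton.mp (Finset.mem_of_subset support_monomial_subset hd'))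
  · exact Or.inr (Finset.mem_singleton.mp (Finset.mem_of_subset support_monomial_subset hd'))

omit [CharP K p] in
/-- **The two re-centred equations `x₁^{2p} x₃ + c·x₁^p x₃` (`c = ±1`)**: clean, `V(z, x₁)` Hironaka-permissible,
and with no equimultiple pair over the exceptional hyperplane (the single chart reads `(x₁^p + c)·x₃`).
[cite: HauserPerlega2019PRIMS, §2] [cite: Hauser2010, §F (equiconstant points)] -/
theorem member_inst₂ [DecidableEq K] (c : K) (hc0 : c ≠ 0) :
    Literature.Barriers.ResolutionOfSingularities.HauserPerlega.IsClean p
        (X 0 ^ (2 * p) * X 2 + C c * (X 0 ^ p * X 2) : MvPolynomial (Fin 4) K) ∧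
      IsPermissibleCentre p ({0} : Finset (Fin 4)) (X 0 ^ (2 * p) * X 2 + C c * (X 0 ^ p * X 2) : MvPolynomial (Fin 4) K) ∧
      ∀ (j : Fin 4) (b : Fin 4 → K), j ∈ ({0} : Finset (Fin 4)) → b j = 0 →
        ¬ CentreBlowup.IsEquimultiplePoint p ({0} : Finset (Fin 4)) j b
          (⟨X 0 ^ (2 * p) * X 2 + C c * (X 0 ^ p * X 2), 0, ∅⟩ : State K) := by
  refine ⟨fun d hd hpth => ?_, ⟨⟨0, Finset.mem_singleton_self _⟩, Finset.le_inf fun d hd => ?_⟩,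
    fun j b hj hbj heq => ?_⟩
  · rcases mem_support_inst₂ hd with rfl | rfl
    · have h0 : (Finsupp.single 0 (2 * p) + Finsupp.single 2 1 : Fin 4 →₀ ℕ) 2 = 1 := by simp
      have h := hpth 2 (by rw [Finsupp.mem_support_iff, h0]; exact one_ne_zero)
      rw [h0] at h
      exact hp.out.one_lt.ne' (Nat.dvd_one.mp h)
    · have h0 : (Finsupp.single 0 p + Finsupp.single 2 1 : Fin 4 →₀ ℕ) 2 = 1 := by simp
      have h := hpth 2 (by rw [Finsupp.mem_support_iff, h0]; exact one_ne_zero)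
      rw [h0] at h
      exact hp.out.one_lt.ne' (Nat.dvd_one.mp h)
  · rcases mem_support_inst₂ hd with rfl | rfl
    · simp [CentreBlowup.degIn]
      exact_mod_cast (by omega : p ≤ 2 * p)
    · simp [CentreBlowup.degIn]
  · rw [Finset.mem_singleton] at hj
    subst hj
    have h1 := heq (Finsupp.single 2 1) (Finsupp.single_ne_zero.mpr one_ne_zero)
      (by rw [Finsupp.degree_single]; exact hp.out.one_lt)
    have hct : CentreBlowup.chartTransform p ({0} : Finset (Fin 4)) 0
        (X 0 ^ (2 * p) * X 2 + C c * (X 0 ^ p * X 2) : MvPolynomial (Fin 4) K) = X 0 ^ p * X 2 + C c * X 2 := by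
      rw [X_pow_mul_X_eq_monomial, X_pow_mul_X_eq_monomial, C_mul_monomial,
        CentreBlowup.chartTransform_monomial_add_monomial, CentreBlowup.chartExponent, CentreBlowup.chartExponent]
      have e1 : (Finsupp.single 0 (2 * p) + Finsupp.single 2 1 : Fin 4 →₀ ℕ).update 0
          (CentreBlowup.degIn ({0} : Finset (Fin 4)) (Finsupp.single 0 (2 * p) + Finsupp.single 2 1 : Fin 4 →₀ ℕ) - p) =
          Finsupp.single 0 p + Finsupp.single 2 1 := by
        ext i; fin_cases i <;> simp [Finsupp.update_apply, CentreBlowup.degIn]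
        omega
      have e2 : (Finsupp.single 0 p + Finsupp.single 2 1 : Fin 4 →₀ ℕ).update 0
          (CentreBlowup.degIn ({0} : Finset (Fin 4)) (Finsupp.single 0 p + Finsupp.single 2 1 : Fin 4 →₀ ℕ) - p) =
          Finsupp.single 2 1 := by
        ext i; fin_cases i <;> simp [Finsupp.update_apply, CentreBlowup.degIn]
      rw [e1, e2, ← X_pow_mul_X_eq_monomial, ← C_mul_monomial]
      rfl
    unfold CentreBlowup.pointTransform PointBlowup.translate at h1
    rw [show (⟨X 0 ^ (2 * p) * X 2 + C c * (X 0 ^ p * X 2), 0, ∅⟩ : State K).F =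
        X 0 ^ (2 * p) * X 2 + C c * (X 0 ^ p * X 2) from rfl, hct] at h1
    simp only [map_add, map_mul, map_pow, aeval_X, aeval_C, MvPolynomial.algebraMap_eq, hbj, map_zero, add_zero] at h1
    have hexp : (X 0 ^ p * (X 2 + C (b 2)) + C c * (X 2 + C (b 2)) : MvPolynomial (Fin 4) K) =
        (X 0 ^ p + C 0 * X 0 ^ 1 + C c) * (X 2 + C (b 2)) := by
      rw [map_zero]
      ring
    rw [hexp, coeff_single_two_mul_X_add_C _ _ (coeff_X_zero_poly hp.out.ne_zero one_ne_zero _ _).1,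
      (coeff_X_zero_poly hp.out.ne_zero one_ne_zero _ _).2] at h1
    exact hc0 h1

omit [CharP K p] in
/-- `x₁^{2p} x₃ − x₁^p x₃ ≠ 0`. [folklore] -/
theorem inst₂_ne_zero : (X 0 ^ (2 * p) * X 2 - X 0 ^ p * X 2 : MvPolynomial (Fin 4) K) ≠ 0 := by
  intro h
  have hc := congrArg (coeff (Finsupp.single (0 : Fin 4) (2 * p) + Finsupp.single 2 1)) h
  rw [coeff_sub, X_pow_mul_X_eq_monomial, X_pow_mul_X_eq_monomial, coeff_monomial, if_pos rfl, coeff_monomial,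
    if_neg, coeff_zero, sub_zero] at hc
  · exact one_ne_zero hc
  · intro heq
    have := DFunLike.congr_fun heq 0
    simp at this
    exact hp.out.ne_zero (by omega)

/-! ## §2 The certificate -/

/-- **`z^p + x₁^{2p} x₃ − x₁^p x₃` ADMITS A MARKED RESOLUTION BY TWO COORDINATE BLOW-UPS** (`K = K̄` of characteristic
`p`, every prime `p`): the joint tree at the root with the two separated initial members `(0, {x₁})` and
`((1,0,0,0), {x₁})` — the disjoint 3-folds `{x₁ = 0}` and `{x₁ = 1}` of the hypersurface — and no point member.
[cite: BierstoneGrigorievMilmanWlodarczyk2011, Def. 3.1.3] [cite: HauserPerlega2019PRIMS, §2] [cite: Hauser2010, §F] -/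
theorem exists_isMarkedResolution_inst₂ [IsAlgClosed K] [DecidableEq K] :
    ∃ (X' : Scheme.{0}) (ρ : X' ⟶ P 4 K) (M' : MarkedIdeal X'),
      IsMarkedResolution (⟨hypSheaf p (X 0 ^ (2 * p) * X 2 - X 0 ^ p * X 2 : MvPolynomial (Fin 4) K), [], p⟩ :
        MarkedIdeal (P 4 K)) ρ M' := by
  set F : MvPolynomial (Fin 4) K := X 0 ^ (2 * p) * X 2 - X 0 ^ p * X 2 with hFdef
  set e : Fin 4 → K := Function.update (0 : Fin 4 → K) 0 1 with he
  have he0 : e 0 = 1 := by rw [he, Function.update_self]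
  have hF₀ : F = X 0 ^ (2 * p) * X 2 + C (-1) * (X 0 ^ p * X 2) := by rw [hFdef, map_neg, map_one]; ring
  have hm₀ := member_inst₂ (K := K) (p := p) (-1) (by norm_num)
  have hm₁ := member_inst₂ (K := K) (p := p) (1 : K) one_ne_zero
  have hclean : Literature.Barriers.ResolutionOfSingularities.HauserPerlega.IsClean p F := by rw [hF₀]; exact hm₀.1
  have hG₀ : deletePthPowers p (PointBlowup.translate (0 : Fin 4 → K) F) = X 0 ^ (2 * p) * X 2 + C (-1) * (X 0 ^ p * X 2) := by
    rw [PointBlowup.translate_zero, hF₀]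
    exact Literature.Barriers.ResolutionOfSingularities.HauserPerlega.deletePthPowers_eq_self hm₀.1
  have hG₁ : deletePthPowers p (PointBlowup.translate e F) = X 0 ^ (2 * p) * X 2 + C 1 * (X 0 ^ p * X 2) := by
    rw [hFdef, translate_update_inst₂, map_one, one_mul]
    have h := Literature.Barriers.ResolutionOfSingularities.HauserPerlega.deletePthPowers_eq_self hm₁.1
    rw [map_one, one_mul] at h
    exact h
  -- the root parameters all lie on the two members
  have hroots : ∀ b' : Fin 4 → K, (∀ d : Fin 4 →₀ ℕ, d ≠ 0 → d.degree < p → coeff d (PointBlowup.translate b' F) = 0) →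
      b' 0 = 0 ∨ b' 0 = 1 := by
    intro b' H
    have h := H (Finsupp.single 2 1) (Finsupp.single_ne_zero.mpr one_ne_zero)
      (by rw [Finsupp.degree_single]; exact hp.out.one_lt)
    rw [hFdef, coeff_single_two_translate_inst₂, sq, ← mul_sub_one, mul_eq_zero] at h
    rcases h with h | h
    · exact Or.inl (pow_eq_zero_iff hp.out.ne_zero |>.mp h)
    · right
      apply frobenius_inj K p
      rw [frobenius_def, frobenius_def, one_pow]
      exact sub_eq_zero.mp h
  refine exists_isMarkedResolution_joint_root F inst₂_ne_zero hclean {((0 : Fin 4 → K), {0}), (e, {0})}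
    (fun bS hbS => ?_) (fun bS hbS bS' hbS' hne => ?_) (Set.finite_empty.subset ?_) (fun b' H hoff => ?_)
  · -- the two members
    rcases Finset.mem_insert.mp hbS with rfl | hbS
    · rw [hG₀]
      exact ⟨hm₀.2.1, Set.finite_empty.subset (by rintro ⟨j, b⟩ ⟨hj, hbj, heq⟩; exact hm₀.2.2 j b hj hbj heq),
        fun j b hj hbj heq => absurd heq (hm₀.2.2 j b hj hbj)⟩
    · rw [Finset.mem_singleton] at hbS
      subst hbS
      rw [hG₁]
      exact ⟨hm₁.2.1, Set.finite_empty.subset (by rintro ⟨j, b⟩ ⟨hj, hbj, heq⟩; exact hm₁.2.2 j b hj hbj heq),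
        fun j b hj hbj heq => absurd heq (hm₁.2.2 j b hj hbj)⟩
  · -- separated at `x₁`
    have key : ∀ bS ∈ ({((0 : Fin 4 → K), ({0} : Finset (Fin 4))), (e, {0})} : Finset ((Fin 4 → K) × Finset (Fin 4))),
        bS.2 = {0} ∧ (bS.1 0 = 0 ∨ bS.1 0 = 1) ∧ (bS.1 0 = 0 → bS = ((0 : Fin 4 → K), {0})) ∧
          (bS.1 0 = 1 → bS = (e, {0})) := by
      intro bS hbS
      rcases Finset.mem_insert.mp hbS with rfl | hbS
      · exact ⟨rfl, Or.inl rfl, fun _ => rfl, fun h => absurd h (by simp)⟩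
      · rw [Finset.mem_singleton] at hbS
        subst hbS
        exact ⟨rfl, Or.inr he0, fun h => absurd (he0.symm.trans h) one_ne_zero, fun _ => rfl⟩
    obtain ⟨hS, h0, h0a, h0b⟩ := key bS hbS
    obtain ⟨hS', h0', h0a', h0b'⟩ := key bS' hbS'
    refine ⟨0, by rw [hS]; exact Finset.mem_singleton_self _, by rw [hS']; exact Finset.mem_singleton_self _, ?_⟩
    intro hh
    rcases h0 with h0 | h0
    · rcases h0' with h0' | h0'
      · exact hne ((h0a h0).trans (h0a' h0').symm)
      · rw [h0, h0'] at hh; exact zero_ne_one hh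
    · rcases h0' with h0' | h0'
      · rw [h0, h0'] at hh; exact one_ne_zero hh
      · exact hne ((h0b h0).trans (h0b' h0').symm)
  · -- no root parameter off the members
    rintro b' ⟨H, hoff⟩
    rcases hroots b' H with h | h
    · exact hoff ((0 : Fin 4 → K), {0}) (Finset.mem_insert_self _ _) (fun i hi => by
        rw [Finset.mem_singleton] at hi; subst hi; exact h)
    · exact hoff (e, {0}) (Finset.mem_insert_of_mem (Finset.mem_singleton_self _)) (fun i hi => by
        rw [Finset.mem_singleton] at hi; subst hi; change b' 0 = e 0; rw [he0]; exact h)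
  · exfalso
    rcases hroots b' H with h | h
    · exact hoff ((0 : Fin 4 → K), {0}) (Finset.mem_insert_self _ _) (fun i hi => by
        rw [Finset.mem_singleton] at hi; subst hi; exact h)
    · exact hoff (e, {0}) (Finset.mem_insert_of_mem (Finset.mem_singleton_self _)) (fun i hi => by
        rw [Finset.mem_singleton] at hi; subst hi; change b' 0 = e 0; rw [he0]; exact h)

end Instance₂

end Equimultiple

end Summit.ResolutionOfSingularities.ResolutionOfSingularities.Theorems.PIDim4

end
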